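import Literature.MathematicalPhysics.QuantumFieldTheory.Balaban1983to89.B9Eq3153FrakGkLipschitzEnergyClosed
import Literature.MathematicalPhysics.QuantumFieldTheory.Balaban1983to89.B7Eq43AveragedSmallnessLinearFeed
import Literature.MathematicalPhysics.QuantumFieldTheory.Balaban1983to89.B9Eq325RLipschitzSqrtTowerPackaged

/-!
# `Balaban1983to89.B9Eq3153FrakGkLipschitzEnergyTwoWindows` — T. Bałaban, *Propagators for lattice gauge theories in a background field*, Commun. Math. Phys.
# **99** (1985) 389–434 [Balaban1985BackgroundPropagators] (3.153) p. 426 with Thm 3.13 p. 426, Thm 3.4 p. 400, Thm 3.11 p. 416 and (3.35)–(3.37) p. 396 AT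
# `k = n+1` AVERAGING LEVELS ON PRINT's DIAGONAL `ηL^{n+1} = 1`: **`𝔊_k(U) − 𝔊_k(1) = O(α)` IN THE FLAT ENERGY NORM ON PRINT's CLASS (3.35) — NO OPERATOR
# LETTER, NO PROFILE BINDER** — ne9-leaf-02's `B9Eq3153FrakGkLipschitzEnergyClosed.exists_norm_frakGk_sub_flat_le_closed` (the row OWNER's INTENT-8 with the
# two `K⁻¹`-letters inhabited) with `C_R` inhabited by this lineage's package and the level-profile binders STRUCK by the α-LINEAR feed (the OWNER's OFFER O-1′)

statement-level skeleton of published theorems with citation tags; proofs where landed; nothing here is a claim about the Yang–Mills mass gap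

CITATION HEADER (lean-in-tree rule).  Audit cell `pub-balaban`, sub-cell `t4`, BINDER row NE9; filed by NE9 formalisation-swarm leaf prover 03
(`b2b-balaban-t4-ne9-formalise-leaf-03`, gen 66), INTENT I-ne9leaf03-g66-F = the OWNER's OFFER O-1′ (W-8) TAKEN (first refusals the OWNER and ne9-leaf-02, host author).  LAYERING OF RECORD (ne9-leaf-02 g66 W-2 (c), the OWNER t4-ne9-p1 g86's W-8 and RULING-R):
OWNER = the host modulo {`C_R`, `C_{K,1}`, `C_{K,U}`}; ne9-leaf-02 = the two `K⁻¹`-letters inhabited, modulo `C_R` + the level profile (`B9Eq3153FrakGkLipschitzEnergyClosed` on the OWNER's INTENT-8); THIS FILE =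
`C_R` inhabited (this lineage's package `B9Eq325RLipschitzSqrtTowerPackaged` of ne9-leaf-04's α-linear letter) + the profile fed α-LINEARLY from the two windows
(`B7Eq43AveragedSmallnessLinearFeed`): NO operator letter, NO profile binder.  Sources READ in the held text `paper:balaban1985-cmp99-background-propagators`
pp. 396, 400, 407, 416, 420, 426.  Objects BY NAME: the owner's `laplaceAk`, `QkW`, `RofUk`, `hessOp`; `frakGLatticeK`, `covCurlL2K`, `covDivL2K`; nothing
re-declared, 0 `def`.

THE PRINT (verbatim).  p. 400, Thm 3.4: *«… describing these analytic extensions as small perturbations of the operators depending on U only»*; p. 396 (3.35):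
the TWO displays of the small-field class — bonds `αη`, plaquettes `αη²` — of which the averaged configurations' smallness (3.37) is a consequence.

WHAT IS PROVED (sorry-free; proof lane — 0 `def`; [folklore] binder plumbing over landed files).
* **`exists_norm_frakGk_sub_flat_le_twoWindows`** — `∃ α₀ C > 0` (closed in `(d, a, L, M_φ, M_φ′, C_τ, ρ_w)`; `C = K·C^{host}(C_R, r = 1∕L)`, `K = 1 + 512(d+1)(d+4)`) BEFORE
  `∀ n η (ηL^{n+1} = 1) (3 ≤ L^{n+1}) c₀ c₁ (c₀(L^{n+1})^d = c₁) (|η|^d∕c₀ ≤ ρ_w) m U (E162's data) S (AvgClosed) (U(b) ∈ S) α (0 ≤ α ≤ α₀) (U(b)* = U(b)⁻¹)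
  (‖U(b) − 1‖ ≤ αη) (‖U(∂p) − 1‖ ≤ αη²)`, ANY `hposU hpos1 hQU hQ1`: the host's three clauses VERBATIM (plain norm, `curl₁`-row, `div₁`-row `≤ C·α·‖·‖`, the flat
  letters written out as in the host).
HONEST SCOPE.  [folklore]; FIRST order at the flat point on the diagonal ONLY; the two WINDOWS, unitarity, E162's data, the trace letters, `ρ_w`, `1 ≤ d`,
`3 ≤ L^{n+1}` and the four witnesses stay HYPOTHESES (the witnesses are theorems on the class); the fine-bond window is NOT derived from plaquettes (torus holonomies;
per cube = the IMS road); no kernel bound, no decay, NOT the (N)-reading; «NE9 ⇐ the named binders»; NE9 NOT PRINTED ∕ NOT PROVED; NOT summit progress (cell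
pub-balaban: row NE9 WALLED ON A MODEL (O-NE9-1; #5 UNRULED); spine PROVED 0/9; rung (B)+1 finite T⁴ — NOT infinite volume, NOT mass gap, NOT BetaPertH, NOT Clay;
HONEST DEPENDENCY: continuum YM on T⁴ ⇐ BetaPertH ∧ nine spine estimates (0/9 proved); BetaPertH ⇐ (D1) ∧ (D4) ∧ CAP+tail; G-an2-4 gates asym, D1 and NE2/3/4).
NEW file; nothing modified.  Net new unproved facts: 0.
-/

noncomputable section

open scoped InnerProductSpace ComplexConjugate BigOperators

namespace Literature.MathematicalPhysics.QuantumFieldTheory.Balaban1983to89.B9Eq3153FrakGkLipschitzEnergyTwoWindows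

open B4Sect5Torus (TSite)
open B9SectCLatticeCarrier (Bond)
open B11Eq103H1Complex (SiteL2K BondL2K covDivL2K frakGLatticeK KinvLatticeK)
open B9Eq310HessianOperator (adTransportW hessOp covCurlL2K)
open B9Eq310HessianHermitian (adTransportW_adjoint)
open B9Eq310DeltaPrime (plaqHolU)
open B9Eq315QTorus (perCfg cornerSite)
open B9Eq315QTower (towerP UlevOf)
open B9Eq315QTowerFlat (perCfg_UlevOf_one_mem_U1 norm_Wcx_UlevOf_one_sub_one_le)
open B9Eq326OperatorTower (laplaceAk QkW RofUk)
open B7Prop1Explicit (U1 Wcx boxVec)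
open B7Prop2Explicit (AvgClosed)
open B9Eq3153FrakGkLipschitzEnergyClosed (exists_norm_frakGk_sub_flat_le_closed)
open B7Eq43AveragedSmallnessLinearFeed (twoWindows_linear_feed)
open B9Eq325RLipschitzSqrtTowerPackaged (exists_norm_RofUk_sub_RofUk_one_le_diagonal)

variable {d : ℕ} (hd : 1 ≤ d) (L : ℕ) [NeZero L] (hL : 1 ≤ L) (hL2 : 2 ≤ L)
  {𝔸 : Type*} [NormedRing 𝔸] [NormedAlgebra ℂ 𝔸] [CompleteSpace 𝔸] [NormOneClass 𝔸] [StarRing 𝔸] [NormedStarGroup 𝔸] [StarModule ℂ 𝔸]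
  {W : Type*} [NormedAddCommGroup W] [InnerProductSpace ℂ W] [FiniteDimensional ℂ W] (φ : W ≃ₗ[ℂ] 𝔸)
  {Mφ Mφ' : ℝ} (hMφ : 0 ≤ Mφ) (hMφ' : 0 ≤ Mφ') (hφ : ∀ w, ‖φ w‖ ≤ Mφ * ‖w‖) (hφ' : ∀ X, ‖φ.symm X‖ ≤ Mφ' * ‖X‖)
  {a : ℝ} (ha : 0 < a) (τ : 𝔸 →ₗ[ℂ] ℂ) {Cτ : ℝ} (hτ : ∀ X, ‖τ X‖ ≤ Cτ * ‖X‖) (hCτ : 0 ≤ Cτ) {ρw : ℝ} (hρw : 0 ≤ ρw)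
  (hτ₁ : ∀ X : 𝔸, τ (star X) = conj (τ X)) (hτ₂ : ∀ X Y : 𝔸, τ (X * Y) = τ (Y * X))
  (hφτ : ∀ X Y : 𝔸, ⟪φ.symm X, φ.symm Y⟫_ℂ = τ (star X * Y))

include hd hL2 hMφ hMφ' hφ hφ' ha hτ hCτ hρw hτ₁ hτ₂ hφτ

set_option maxRecDepth 8192 in
/-- **THE LETTER ON PRINT's CLASS (3.35) — NO OPERATOR LETTER, NO PROFILE BINDER**: there are `α₀, C > 0` (closed in `(d, a, L, M_φ, M_φ′, C_τ, ρ_w)`) such that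
for every `n` with `3 ≤ L^{n+1}`, `η` (`ηL^{n+1} = 1`), `c₀, c₁` (`c₀(L^{n+1})^d = c₁`, `|η|^d∕c₀ ≤ ρ_w`), `m`, background `U` of E162's data valued in an
averaging-closed `S`, `0 ≤ α ≤ α₀`, unitary (`U(b)* = U(b)⁻¹`), in the two windows `‖U(b) − 1‖ ≤ αη`, `‖U(∂p) − 1‖ ≤ αη²`, ANY positivity witnesses `hposU`,
`hpos1`, ANY onto-witnesses `hQU`, `hQ1`: the three rows of ne9-leaf-02's `exists_norm_frakGk_sub_flat_le_closed` (plain norm, `curl₁`, `div₁` `≤ C·α·‖·‖`), that theorem taken at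
`r = 1∕L` and at the packaged `R`-letter's `C_R` (`hRS` from unitarity by `adTransportW_adjoint`), fed at `β = Kα` by `twoWindows_linear_feed`.
[cite: Balaban1985BackgroundPropagators, Thm 3.4 p.400, (3.84)–(3.86) p.407, (3.126) p.420, (3.153) p.426, (3.25) p.394, p.403, Thm 3.11 p.416, (3.35)–(3.37) p.396; Balaban1985Variational, (45)–(46) p.285; Balaban1985Averaging, Prop. 2 (52)–(54) p.26] -/
theorem exists_norm_frakGk_sub_flat_le_twoWindows :
    ∃ α₀ C : ℝ, 0 < α₀ ∧ 0 < C ∧ ∀ (n : ℕ) (η : ℝ), η * (L : ℝ) ^ (n + 1) = 1 → 3 ≤ L ^ (n + 1) →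
      ∀ (c₀ c₁ : ℝ) [Fact (0 < c₀)] [Fact (0 < c₁)], c₀ * ((L : ℝ) ^ (n + 1)) ^ d = c₁ → |η| ^ d / c₀ ≤ ρw →
      ∀ (m : Fin d → ℕ) [∀ i, NeZero (m i)] (U : Bond d (towerP L m (n + 1)) → 𝔸ˣ) (αU : ℕ → ℝ) (hα1 : ∀ j, αU j ≤ 1 / 64)
        (hU1 : ∀ (j : ℕ) (x : B7Prop1Explicit.Site d) (κ : Fin d), perCfg (towerP L m (j + 1)) (UlevOf L m (n + 1) U j) x κ ∈ U1 𝔸)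
        (hreg : ∀ (j : ℕ) (y : TSite d (towerP L m j)) (κ : Fin d) (r : Fin d → Fin L),
          ‖((Wcx L (perCfg (towerP L m (j + 1)) (UlevOf L m (n + 1) U j)) (cornerSite L y) κ (boxVec L r) : 𝔸ˣ) : 𝔸) - 1‖ ≤ αU j)
        {S : Subgroup 𝔸ˣ}, AvgClosed d L S → (∀ b, U b ∈ S) →
      ∀ {α : ℝ}, 0 ≤ α → α ≤ α₀ →
        (∀ b, star (U b : 𝔸) = (((U b)⁻¹ : 𝔸ˣ) : 𝔸)) →
        (∀ b, ‖(U b : 𝔸) - 1‖ ≤ α * η) →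
        (∀ p : B9SectCLatticeCarrier.Plaq d (towerP L m (n + 1)), ‖(plaqHolU U p : 𝔸) - 1‖ ≤ α * η ^ 2) →
        ∀ (hposU : ∀ x : BondL2K ℂ d (towerP L m (n + 1)) c₀ W, x ≠ 0 →
            0 < RCLike.re ⟪x, laplaceAk L m n φ η U hL αU hα1 hU1 hreg τ (c₀ := c₀) (c₁ := c₁) a x⟫_ℂ)
          (hpos1 : ∀ x : BondL2K ℂ d (towerP L m (n + 1)) c₀ W, x ≠ 0 →
            0 < RCLike.re ⟪x, laplaceAk L m n φ η (fun _ : Bond d (towerP L m (n + 1)) => (1 : 𝔸ˣ)) hL (fun _ => 0) (fun _ => by norm_num)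
              (perCfg_UlevOf_one_mem_U1 L m (n + 1)) (norm_Wcx_UlevOf_one_sub_one_le L m (n + 1) (fun _ => 0) (fun _ => le_rfl)) τ
              (c₀ := c₀) (c₁ := c₁) a x⟫_ℂ)
          (hQU : Function.Surjective (QkW L m n φ U hL αU hα1 hU1 hreg (c₀ := c₀) (c₁ := c₁)))
          (hQ1 : Function.Surjective (QkW L m n φ (fun _ : Bond d (towerP L m (n + 1)) => (1 : 𝔸ˣ)) hL (fun _ => 0) (fun _ => by norm_num)
            (perCfg_UlevOf_one_mem_U1 L m (n + 1)) (norm_Wcx_UlevOf_one_sub_one_le L m (n + 1) (fun _ => 0) (fun _ => le_rfl)) (c₀ := c₀) (c₁ := c₁))),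
        ∀ x : BondL2K ℂ d (towerP L m (n + 1)) c₀ W,
          ‖frakGLatticeK hposU hQU x - frakGLatticeK (c := ((η : ℂ))⁻¹) (R := adTransportW φ (fun _ : Bond d (towerP L m (n + 1)) => (1 : 𝔸ˣ)))
              (S := adTransportW φ fun _ : Bond d (towerP L m (n + 1)) => (1 : 𝔸ˣ)⁻¹) (Δ₁ := hessOp φ η (fun _ : Bond d (towerP L m (n + 1)) => (1 : 𝔸ˣ)) τ)
              (Rr := RofUk L m n φ η (fun _ : Bond d (towerP L m (n + 1)) => (1 : 𝔸ˣ)))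
              (Q := (QkW L m n φ (fun _ : Bond d (towerP L m (n + 1)) => (1 : 𝔸ˣ)) hL (fun _ => 0) (fun _ => by norm_num)
            (perCfg_UlevOf_one_mem_U1 L m (n + 1)) (norm_Wcx_UlevOf_one_sub_one_le L m (n + 1) (fun _ => 0) (fun _ => le_rfl)) (c₀ := c₀) (c₁ := c₁))) (a := a) hpos1 hQ1 x‖ ≤ C * α * ‖x‖ ∧
          ‖covCurlL2K ℂ c₀ ((η : ℂ))⁻¹ (adTransportW φ (fun _ : Bond d (towerP L m (n + 1)) => (1 : 𝔸ˣ)))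
            (frakGLatticeK hposU hQU x - frakGLatticeK (c := ((η : ℂ))⁻¹) (R := adTransportW φ (fun _ : Bond d (towerP L m (n + 1)) => (1 : 𝔸ˣ)))
              (S := adTransportW φ fun _ : Bond d (towerP L m (n + 1)) => (1 : 𝔸ˣ)⁻¹) (Δ₁ := hessOp φ η (fun _ : Bond d (towerP L m (n + 1)) => (1 : 𝔸ˣ)) τ)
              (Rr := RofUk L m n φ η (fun _ : Bond d (towerP L m (n + 1)) => (1 : 𝔸ˣ)))
              (Q := (QkW L m n φ (fun _ : Bond d (towerP L m (n + 1)) => (1 : 𝔸ˣ)) hL (fun _ => 0) (fun _ => by norm_num)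
            (perCfg_UlevOf_one_mem_U1 L m (n + 1)) (norm_Wcx_UlevOf_one_sub_one_le L m (n + 1) (fun _ => 0) (fun _ => le_rfl)) (c₀ := c₀) (c₁ := c₁))) (a := a) hpos1 hQ1 x)‖ ≤ C * α * ‖x‖ ∧
          ‖covDivL2K ℂ c₀ ((η : ℂ))⁻¹ (adTransportW φ fun _ : Bond d (towerP L m (n + 1)) => (1 : 𝔸ˣ)⁻¹)
            (frakGLatticeK hposU hQU x - frakGLatticeK (c := ((η : ℂ))⁻¹) (R := adTransportW φ (fun _ : Bond d (towerP L m (n + 1)) => (1 : 𝔸ˣ)))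
              (S := adTransportW φ fun _ : Bond d (towerP L m (n + 1)) => (1 : 𝔸ˣ)⁻¹) (Δ₁ := hessOp φ η (fun _ : Bond d (towerP L m (n + 1)) => (1 : 𝔸ˣ)) τ)
              (Rr := RofUk L m n φ η (fun _ : Bond d (towerP L m (n + 1)) => (1 : 𝔸ˣ)))
              (Q := (QkW L m n φ (fun _ : Bond d (towerP L m (n + 1)) => (1 : 𝔸ˣ)) hL (fun _ => 0) (fun _ => by norm_num)
            (perCfg_UlevOf_one_mem_U1 L m (n + 1)) (norm_Wcx_UlevOf_one_sub_one_le L m (n + 1) (fun _ => 0) (fun _ => le_rfl)) (c₀ := c₀) (c₁ := c₁))) (a := a) hpos1 hQ1 x)‖ ≤ C * α * ‖x‖ := by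
  have hL0 : (0 : ℝ) < L := by exact_mod_cast lt_of_lt_of_le (by norm_num) hL2
  have hr0 : (0 : ℝ) ≤ 1 / (L : ℝ) := by positivity
  have hr1 : 1 / (L : ℝ) < 1 := by rw [div_lt_one hL0]; exact_mod_cast lt_of_lt_of_le (by norm_num) hL2
  -- the packaged `R`-letter and ne9-leaf-02's closed host, opened once at its constant
  obtain ⟨αR, CR, hαR, hCR, HR⟩ := exists_norm_RofUk_sub_RofUk_one_le_diagonal L φ hMφ hMφ' hφ hφ' hr0 hr1
  obtain ⟨α₁, C, hα₁, hC, H⟩ := exists_norm_frakGk_sub_flat_le_closed hd L hL φ hMφ hMφ' hφ hφ' ha hr0 hr1 τ hτ hCτ hρw hCR.le hτ₁ hτ₂ hφτ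
  -- the α-linear feed below both thresholds
  obtain ⟨T, hT, F⟩ := twoWindows_linear_feed L hL2 (d := d) (𝔸 := 𝔸) (lt_min hα₁ hαR)
  refine ⟨T, C * (1 + 512 * (d + 1) * (d + 4)), hT, by positivity, ?_⟩
  intro n η hηL hL3 c₀ c₁ _ _ hw hρ m _ U αU hα1 hU1 hreg S hS hU α hα0 hαle hUst hUη hpl hposU hpos1 hQU hQ1 x
  obtain ⟨hβ0, hβ1, hUb, hUη', hpl', hLb, εU, hεU, hUε, hεg⟩ := F m n hS hU hηL hα0 hαle hUη hpl
  have hRS : ∀ (b : Bond d (towerP L m (n + 1))) (v u : W), ⟪adTransportW φ U b v, u⟫_ℂ = ⟪v, adTransportW φ (fun b => (U b)⁻¹) b u⟫_ℂ :=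
    adTransportW_adjoint φ τ hτ₂ hUst hφτ
  have hR := HR n η hηL c₀ c₁ hw m U εU hεU hUε hLb hβ0 (hβ1.trans (min_le_right _ _)) hRS hUb hUη' hεg
  obtain ⟨h1, h2, h3⟩ := H n η hηL hL3 c₀ c₁ hw hρ m U αU hα1 hU1 hreg εU hεU hUε hβ0 (hβ1.trans (min_le_left _ _)) hUst hUb hUη' hpl' hεg hR
    hposU hpos1 hQU hQ1 x
  exact ⟨h1.trans_eq (by ring), h2.trans_eq (by ring), h3.trans_eq (by ring)⟩

end Literature.MathematicalPhysics.QuantumFieldTheory.Balaban1983to89.B9Eq3153FrakGkLipschitzEnergyTwoWindows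

end
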